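import Mathlib.MeasureTheory.Measure.HasOuterApproxClosed
import Mathlib.MeasureTheory.Integral.DominatedConvergence
import Literature.Probability.RandomPlanarGeometry.ChordalCurveFamily
import Literature.Probability.RandomPlanarGeometry.ConformalRestrictionProofs
import Literature.Probability.RandomPlanarGeometry.ImageUnivalent
import HarnessLib

/-!
# Radó continuity of a chordal curve family

Topic `Literature/Probability/RandomPlanarGeometry`; definition item
`defn-ChordalFamily.IsRadoContinuous` for route `CriticalPhenomena/SAWRestrictionDescent`
(item `stmt-CriticalPhenomena-7305` `ContinuityOfLimit`, whose CONCLUSION clause it is, and item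
`stmt-CriticalPhenomena-8479` `TopRes`, where the same clause is a hypothesis).

For a chordal curve family `P : DobrushinDomain → Measure (CurveClass ℂ)` (`ChordalFamily`),
**`P.IsRadoContinuous`** says that `D ↦ P D` is *sequentially continuous along conformal images,
for the weak topology on laws*: whenever

* `D` is a Dobrushin domain `(D; a, b)` (`a = D.pt 0`, `b = D.pt 1`),
* `Φ, Φ_n : ℂ → ℂ` are continuous, conformal (complex differentiable) on `D` and injective on
  `closure D`, with `Φ_n → Φ` uniformly on `closure D`,
* `D'` is ANY Dobrushin domain with carrier `Φ(D)` and marks `Φ(a), Φ(b)`, and `D_n` ANY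
  Dobrushin domains with carriers `Φ_n(D)` and marks `Φ_n(a), Φ_n(b)`,

then `P D_n ⇀ P D'` weakly, i.e. `∫ f d(P D_n) → ∫ f d(P D')` for every bounded continuous
`f : CurveClass ℂ → ℝ`. The body is VERBATIM the clause inlined in the two route items, so they
restate by `Iff.rfl` (`ChordalFamily.isRadoContinuous_iff`).

The name. The mode of convergence of the marked domains `D_n = Φ_n(D) → Φ(D) = D'` — uniform
convergence ON THE CLOSED DOMAIN of univalent parametrisations over a fixed Jordan domain — is the
conclusion of **Radó's theorem** (T. Radó 1923; Ch. Pommerenke, *Boundary Behaviour of Conformal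
Maps* (1992), §2.3 Thm. 2.11, book p. 26: if the boundary Jordan curves converge uniformly as
parametrised loops, the normalised Riemann maps `f_n : 𝔻 → D_n` converge uniformly on `𝔻̄`),
which the tree holds as the named fact `JordanDomain.rado_tendstoUniformlyOn` (`RadoConvergence.lean`),
discharged in `RadoConvergenceProofs.lean`. So, for `D = 𝔻`, a sequence of Jordan domains whose
boundary loops converge uniformly, marked at the images of two fixed points of `∂𝔻`, satisfies
the hypotheses with `Φ_n, Φ` continuous extensions to `ℂ` (Carathéodory, then Tietze) of the
normalised Riemann maps; the definition allows any Dobrushin domain `D` as parameter domain, as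
the route items do, and asserts no converse.

## API

* `isRadoContinuous_iff` — unfolding (`Iff.rfl`).
* `IsRadoContinuous.integral_eq_of_carrier_eq`, `.eq_of_carrier_eq`, `.eq_of_isChordal` — the
  constant-sequence case `Φ_n = Φ = id`: a Radó-continuous family of finite laws depends on a
  Dobrushin domain only through `(carrier, a, b)` (not through the boundary parametrisation), the
  remark "with constant sequences this also says `P D` depends on `(carrier, a, b)` only" of item
  `stmt-CriticalPhenomena-7305`.
* `IsRadoContinuous.tendsto_image` — the specialisation to the image domains
  `MarkedDomain.image` (`ImageUnivalent.lean`), which shows that the eight hypotheses are jointly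
  satisfiable for every `D`, `Φ`, `Φ_n` as above (the quantified `D'`, `D_n` exist).
* `IsConformallyCovariant.isRadoContinuous` — **a conformally covariant family of finite laws
  carried by curves in `closure D` is Radó-continuous** (in particular a conformally covariant
  chordal family, `IsConformallyCovariant.isRadoContinuous_of_isChordal`): `P D_n = (Φ_n)_* (P D)`,
  `P D' = Φ_* (P D)` (`IsConformallyCovariant.eq_map_of_image`, through `ConformalEquiv.ofInjOn`),
  and `Φ_n ∘ γ → Φ ∘ γ` in curve space for every curve `γ ⊆ closure D`
  (`CurveClass.tendsto_map_of_tendstoUniformlyOn`), so dominated convergence applies. This is the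
  mechanism of the remark "trivially implied by the conjunct (SLE_{8/3} is conformally covariant,
  so `P(D_n) = (Φ_n)_* P(D) → Φ_* P(D) = P(D')`)" of item `stmt-CriticalPhenomena-7305`; the SLE_κ
  instance is `isRadoContinuous_of_isSLELaw`, with the tree's named facts
  `Process.isProjectiveLimit_preWienerMeasure`, `IsSLELaw.conformalCovariance` and
  `JordanDomain.mapsTo_boundaryExtension` as explicit hypotheses — all three are discharged in
  leaf files (`isProjectiveLimit_preWienerMeasure_holds` in `LocalMartingaleProofs.lean`,
  `IsSLELaw.conformalCovariance_holds` in `ConformalRestrictionCovariance.lean`,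
  `JordanDomain.mapsTo_boundaryExtension_holds` in `CaratheodoryHalfPlaneProofs.lean`) and are
  hypotheses here only to keep those import cones out of a definition file.
* `isRadoContinuous_tipFamily` — an unconditional inhabitant: the degenerate test family "stay at
  `a`" of `ChordalCurveFamily.lean` is Radó-continuous (its law in `D_n` is the Dirac mass at the
  constant curve at `Φ_n(a) → Φ(a)`).

## Design notes

* Test functions are real bounded continuous functions and the index set is `ℕ` (sequential
  continuity), verbatim as in the route items; for finite Borel laws on the metric space
  `CurveClass ℂ` convergence of these integrals is weak convergence (portmanteau), and equality of
  all of them is equality of laws (`MeasureTheory.ext_of_forall_integral_eq_of_IsFiniteMeasure`,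
  used in `eq_of_carrier_eq`).
* `D'` and the `D_n` are quantified over ALL Dobrushin structures with the prescribed carrier and
  marks rather than constructed as `MarkedDomain.image`: this is what makes the constant-sequence
  consequence (`eq_of_carrier_eq`) part of the notion, and it keeps the clause free of the
  `ImageUnivalent` import on the route side.
* Not here: Radó's theorem itself (see `RadoConvergence.lean`), continuity under Carathéodory
  KERNEL convergence (a weaker convergence of domains, which does not control the boundary near
  the marked points), and any claim that the SAW scaling limit is Radó-continuous (that is the
  content of item `stmt-CriticalPhenomena-7305`).

## References

* Ch. Pommerenke, *Boundary Behaviour of Conformal Maps*, Grundlehren 299, Springer (1992), §2.3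
  Thm. 2.11 (Radó's theorem), book p. 26 [`PommerenkeBBCM1992`]; T. Radó, *Sur la représentation
  conforme de domaines variables*, Acta Sci. Math. (Szeged) 1 (1923) 180–186.
* G. F. Lawler, O. Schramm, W. Werner, *On the scaling limit of planar self-avoiding walk*, Proc.
  Sympos. Pure Math. 72 (2004), §2 (conformal invariance of the conjectural SAW scaling limit)
  [`LawlerSchrammWerner2004SAW`].
* M. Aizenman, A. Burchard, Duke Math. J. 99 (1999) §2.1 (the curve space).

## Mathlib / tree

Mathlib: `TendstoUniformlyOn`, `Metric.tendstoUniformlyOn_iff`, `TendstoUniformlyOn.tendsto_at`,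
`ContinuousMap.dist_le`, `MeasureTheory.integral_map`,
`MeasureTheory.tendsto_integral_of_dominated_convergence`,
`MeasureTheory.ext_of_forall_integral_eq_of_IsFiniteMeasure`, `MeasureTheory.integral_dirac`.
Tree: `ChordalFamily`, `IsChordal`, `IsConformallyCovariant`, `tipFamily` (`ChordalCurveFamily`);
`Curve.dist_le_dist_toContinuousMap`, `CurveClass.map` (`Curve`, `CurveSpace`);
`CurveClass.continuous_map`, `CurveClass.measurable_map`, `ConformalEquiv.hasBoundaryValue_of_eqOn`,
`IsSLELaw.conformalCovariance`, `IsSLELaw.ae_endpoints` (`ConformalRestrictionProofs`);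
`IsSLELaw.isProbabilityMeasure` (`SLE`); `ConformalEquiv.ofInjOn`, `MarkedDomain.image`
(`ImageUnivalent`). Searched (`lean search`): no `RadoContinuous` / weak-continuity-in-the-domain
predicate for chordal families existed (2026-08-15).
-/

noncomputable section

open Set Filter MeasureTheory Topology
open scoped NNReal BoundedContinuousFunction

namespace Literature.Probability.RandomPlanarGeometry

/-! ### Push-forwards of curves along uniformly convergent maps -/

namespace Curve

variable {E F : Type*} [PseudoMetricSpace E] [PseudoMetricSpace F]

/-- If two continuous maps are `C`-close on the trace of a curve, the two push-forwards of the
curve are `C`-close for the reparametrisation distance (compare the identity reparametrisation;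
Aizenman–Burchard 1999, §2.1). [folklore] -/
theorem dist_map_map_le_of_forall_mem_range {Φ Ψ : C(E, F)} {γ : Curve E} {C : ℝ} (hC : 0 ≤ C)
    (h : ∀ x ∈ γ.range, dist (Φ x) (Ψ x) ≤ C) : dist (γ.map Φ) (γ.map Ψ) ≤ C :=
  (dist_le_dist_toContinuousMap _ _).trans
    ((ContinuousMap.dist_le hC).2 fun t ↦ h (γ t) ⟨t, rfl⟩)

/-- The constant curve depends `1`-Lipschitz on its point. [folklore] -/
theorem lipschitzWith_const : LipschitzWith 1 (const : E → Curve E) :=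
  LipschitzWith.mk_one fun _ _ ↦
    (dist_le_dist_toContinuousMap _ _).trans ((ContinuousMap.dist_le dist_nonneg).2 fun _ ↦ le_rfl)

/-- **Uniform convergence of the maps on the trace gives convergence of the push-forwards**: if
`Φ_n → Φ` uniformly on a set `K` containing the trace of `γ`, then `Φ_n ∘ γ → Φ ∘ γ` for the
reparametrisation distance. [folklore] -/
theorem tendsto_map_of_tendstoUniformlyOn {ι : Type*} {l : Filter ι} {K : Set E} {Φ : C(E, F)}
    {Φn : ι → C(E, F)} (h : TendstoUniformlyOn (fun n ↦ ⇑(Φn n)) Φ l K) {γ : Curve E}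
    (hγ : γ.range ⊆ K) : Tendsto (fun n ↦ γ.map (Φn n)) l (𝓝 (γ.map Φ)) := by
  rw [Metric.tendsto_nhds]
  intro ε hε
  filter_upwards [Metric.tendstoUniformlyOn_iff.1 h (ε / 2) (half_pos hε)] with n hn
  refine lt_of_le_of_lt (dist_map_map_le_of_forall_mem_range (half_pos hε).le fun x hx ↦ ?_)
    (half_lt_self hε)
  rw [dist_comm]
  exact (hn x (hγ hx)).le

end Curve

namespace CurveClass

variable {E F : Type*} [MetricSpace E] [PseudoMetricSpace F]

/-- The class of the constant curve depends continuously on its point. [folklore] -/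
theorem continuous_mk_const : Continuous fun x : E ↦ mk (Curve.const x) :=
  continuous_mk.comp Curve.lipschitzWith_const.continuous

/-- **Uniform convergence of the maps on the trace gives convergence of the image classes**: if
`Φ_n → Φ` uniformly on a set `K` containing the trace of the curve class `c`, then
`c.map Φ_n → c.map Φ` in `CurveClass F`. (The estimate
`dist (c.map Φ_n) (c.map Φ) ≤ sup_K dist (Φ_n, Φ)`, Aizenman–Burchard 1999 §2.1.) [folklore] -/
theorem tendsto_map_of_tendstoUniformlyOn {ι : Type*} {l : Filter ι} {K : Set E} {Φ : C(E, F)}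
    {Φn : ι → C(E, F)} (h : TendstoUniformlyOn (fun n ↦ ⇑(Φn n)) Φ l K) (c : CurveClass E)
    (hc : c.range ⊆ K) : Tendsto (fun n ↦ map (Φn n) c) l (𝓝 (map Φ c)) := by
  obtain ⟨γ, rfl⟩ := surjective_mk c
  simp only [map_mk]
  exact (continuous_mk.tendsto _).comp (Curve.tendsto_map_of_tendstoUniformlyOn h hc)

end CurveClass

/-! ### Radó continuity -/

namespace ChordalFamily

/-- **Radó continuity of a chordal curve family** (`D ↦ P D` is sequentially continuous along
conformal images, for the weak topology): for every Dobrushin domain `(D; a, b)`, all continuous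
`Φ, Φ_n : ℂ → ℂ` that are complex differentiable on `D` and injective on `closure D` with
`Φ_n → Φ` uniformly on `closure D`, every Dobrushin domain `D'` with carrier `Φ '' D` and marks
`Φ a, Φ b`, and all Dobrushin domains `D_n` with carriers `Φ_n '' D` and marks `Φ_n a, Φ_n b`,
the laws converge weakly: `∫ f d(P D_n) → ∫ f d(P D')` for every bounded continuous real `f` on
curve classes. The convergence `Φ_n → Φ` uniformly on the closed domain is the conclusion of
Radó's theorem on varying Jordan domains (Radó 1923; Pommerenke 1992, §2.3 Thm. 2.11; tree:
`JordanDomain.rado_tendstoUniformlyOn`), whence the name. Verbatim the conclusion clause of item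
`stmt-CriticalPhenomena-7305` (`ContinuityOfLimit`) and the continuity hypothesis of item
`stmt-CriticalPhenomena-8479` (`TopRes`) of route `SAWRestrictionDescent`. [folklore] -/
def IsRadoContinuous (P : ChordalFamily) : Prop :=
  ∀ (D D' : DobrushinDomain) (Dn : ℕ → DobrushinDomain) (Φ : C(ℂ, ℂ)) (Φn : ℕ → C(ℂ, ℂ)),
    TendstoUniformlyOn (fun n => ⇑(Φn n)) Φ Filter.atTop (closure D.carrier) →
    DifferentiableOn ℂ Φ D.carrier → Set.InjOn Φ (closure D.carrier) →
    (∀ n, DifferentiableOn ℂ (Φn n) D.carrier ∧ Set.InjOn (Φn n) (closure D.carrier)) →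
    D'.carrier = Φ '' D.carrier → D'.pt 0 = Φ (D.pt 0) → D'.pt 1 = Φ (D.pt 1) →
    (∀ n, (Dn n).carrier = Φn n '' D.carrier ∧ (Dn n).pt 0 = Φn n (D.pt 0) ∧
      (Dn n).pt 1 = Φn n (D.pt 1)) →
    ∀ f : BoundedContinuousFunction (CurveClass ℂ) ℝ,
      Filter.Tendsto (fun n => ∫ γ, f γ ∂(P (Dn n))) Filter.atTop (nhds (∫ γ, f γ ∂(P D')))

variable {P : ChordalFamily}

/-- Unfolding lemma (definitional; literally the clause inlined in route `SAWRestrictionDescent`).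
[folklore] -/
theorem isRadoContinuous_iff (P : ChordalFamily) :
    P.IsRadoContinuous ↔
      ∀ (D D' : DobrushinDomain) (Dn : ℕ → DobrushinDomain) (Φ : C(ℂ, ℂ)) (Φn : ℕ → C(ℂ, ℂ)),
        TendstoUniformlyOn (fun n => ⇑(Φn n)) Φ Filter.atTop (closure D.carrier) →
        DifferentiableOn ℂ Φ D.carrier → Set.InjOn Φ (closure D.carrier) →
        (∀ n, DifferentiableOn ℂ (Φn n) D.carrier ∧ Set.InjOn (Φn n) (closure D.carrier)) →
        D'.carrier = Φ '' D.carrier → D'.pt 0 = Φ (D.pt 0) → D'.pt 1 = Φ (D.pt 1) →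
        (∀ n, (Dn n).carrier = Φn n '' D.carrier ∧ (Dn n).pt 0 = Φn n (D.pt 0) ∧
          (Dn n).pt 1 = Φn n (D.pt 1)) →
        ∀ f : BoundedContinuousFunction (CurveClass ℂ) ℝ,
          Filter.Tendsto (fun n => ∫ γ, f γ ∂(P (Dn n))) Filter.atTop
            (nhds (∫ γ, f γ ∂(P D'))) :=
  Iff.rfl

/-! #### The constant-sequence case: the law depends on `(carrier, a, b)` only -/

/-- **A Radó-continuous family integrates bounded continuous functions identically over two
Dobrushin structures with the same carrier and the same marked points** (constant sequence
`Φ_n = Φ = id`, `D_n = D₁`, `D' = D₂` over the parameter domain `D₂`: a constant sequence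
converging to `∫ f d(P D₂)` is equal to it). [folklore] -/
theorem IsRadoContinuous.integral_eq_of_carrier_eq (h : P.IsRadoContinuous)
    {D₁ D₂ : DobrushinDomain} (hc : D₁.carrier = D₂.carrier) (h0 : D₁.pt 0 = D₂.pt 0)
    (h1 : D₁.pt 1 = D₂.pt 1) (f : CurveClass ℂ →ᵇ ℝ) :
    ∫ γ, f γ ∂(P D₁) = ∫ γ, f γ ∂(P D₂) := by
  have hid : TendstoUniformlyOn (fun _ : ℕ ↦ ⇑(ContinuousMap.id ℂ)) (ContinuousMap.id ℂ) atTop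
      (closure D₂.carrier) :=
    Metric.tendstoUniformlyOn_iff.2 fun ε hε ↦ Eventually.of_forall fun n x _ ↦ by
      rwa [dist_self]
  have hd : DifferentiableOn ℂ (ContinuousMap.id ℂ) D₂.carrier := differentiableOn_id
  have hi : InjOn (ContinuousMap.id ℂ) (closure D₂.carrier) := injOn_id _
  have hlim := h D₂ D₂ (fun _ ↦ D₁) (ContinuousMap.id ℂ) (fun _ ↦ ContinuousMap.id ℂ) hid hd hi
    (fun _ ↦ ⟨hd, hi⟩) (by simp) rfl rfl (fun _ ↦ ⟨by simpa using hc, h0, h1⟩) f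
  exact tendsto_nhds_unique tendsto_const_nhds hlim

/-- **A Radó-continuous family of finite laws depends on a Dobrushin domain only through its
carrier and its two marked points** (not through the boundary parametrisation): finite Borel laws
on the metric space `CurveClass ℂ` with the same integrals of bounded continuous functions are
equal. The remark "with constant sequences this also says `P D` depends on `(carrier, a, b)`
only" of item `stmt-CriticalPhenomena-7305`. [folklore] -/
theorem IsRadoContinuous.eq_of_carrier_eq (h : P.IsRadoContinuous) {D₁ D₂ : DobrushinDomain}
    [IsFiniteMeasure (P D₁)] [IsFiniteMeasure (P D₂)] (hc : D₁.carrier = D₂.carrier)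
    (h0 : D₁.pt 0 = D₂.pt 0) (h1 : D₁.pt 1 = D₂.pt 1) : P D₁ = P D₂ :=
  ext_of_forall_integral_eq_of_IsFiniteMeasure fun f ↦ h.integral_eq_of_carrier_eq hc h0 h1 f

/-- The same for a chordal family (all `P D` are probability measures). [folklore] -/
theorem IsRadoContinuous.eq_of_isChordal (h : P.IsRadoContinuous) (hP : P.IsChordal)
    {D₁ D₂ : DobrushinDomain} (hc : D₁.carrier = D₂.carrier) (h0 : D₁.pt 0 = D₂.pt 0)
    (h1 : D₁.pt 1 = D₂.pt 1) : P D₁ = P D₂ := by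
  haveI := (hP D₁).1
  haveI := (hP D₂).1
  exact h.eq_of_carrier_eq hc h0 h1

/-! #### The hypotheses are jointly satisfiable: image domains -/

/-- **Radó continuity along the image domains.** For `Φ, Φ_n` continuous, conformal on `D` and
injective on `closure D` with `Φ_n → Φ` uniformly on `closure D`, the image Dobrushin domains
`Φ_n(D; a, b)`, `Φ(D; a, b)` (`MarkedDomain.image`: carrier `Φ '' D`, loop `Φ ∘ ∂D`, marks
`Φ a, Φ b`; a Jordan domain by invariance of domain and Pommerenke 1992 Thm. 2.6) satisfy the
carrier/mark clauses definitionally, so `P (Φ_n D) ⇀ P (Φ D)`. In particular the quantified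
domains `D'`, `D_n` of `IsRadoContinuous` always exist. [folklore] -/
theorem IsRadoContinuous.tendsto_image (h : P.IsRadoContinuous) {D : DobrushinDomain}
    {Φ : C(ℂ, ℂ)} {Φn : ℕ → C(ℂ, ℂ)}
    (hunif : TendstoUniformlyOn (fun n ↦ ⇑(Φn n)) Φ atTop (closure D.carrier))
    (hΦd : DifferentiableOn ℂ Φ D.carrier) (hΦi : InjOn Φ (closure D.carrier))
    (hΦnd : ∀ n, DifferentiableOn ℂ (Φn n) D.carrier)
    (hΦni : ∀ n, InjOn (Φn n) (closure D.carrier)) (f : CurveClass ℂ →ᵇ ℝ) :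
    Tendsto
      (fun n ↦ ∫ γ, f γ ∂(P (D.image (Φn n) (Φn n).continuous.continuousOn (hΦni n))))
      atTop (𝓝 (∫ γ, f γ ∂(P (D.image Φ Φ.continuous.continuousOn hΦi)))) :=
  h D _ _ Φ Φn hunif hΦd hΦi (fun n ↦ ⟨hΦnd n, hΦni n⟩) rfl rfl rfl (fun _ ↦ ⟨rfl, rfl, rfl⟩) f

/-! #### Conformal covariance implies Radó continuity -/

/-- **A conformally covariant family transports along univalent maps**: if `Φ` is continuous on
`ℂ`, complex differentiable and injective on `D`, and `D'` is a Dobrushin domain with carrier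
`Φ '' D` and marks `Φ a, Φ b`, then `P D' = Φ_* (P D)`. (`Φ|D : D → D'` is a conformal
equivalence, `ConformalEquiv.ofInjOn` — inverse holomorphic by Fritzsche–Grauert Cor. I.8.6 — with
boundary values `Φ a`, `Φ b` at `a`, `b` by continuity of `Φ`.) [folklore] -/
theorem IsConformallyCovariant.eq_map_of_image (hcov : P.IsConformallyCovariant)
    {D D' : DobrushinDomain} {Φ : C(ℂ, ℂ)} (hΦd : DifferentiableOn ℂ Φ D.carrier)
    (hΦi : InjOn Φ D.carrier) (hD' : D'.carrier = Φ '' D.carrier) (h0 : D'.pt 0 = Φ (D.pt 0))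
    (h1 : D'.pt 1 = Φ (D.pt 1)) : P D' = (P D).map (CurveClass.map Φ) := by
  have heq : EqOn Φ (ConformalEquiv.ofInjOn Φ D.isOpen hΦd hΦi hD'.symm) D.carrier :=
    fun _ _ ↦ rfl
  refine hcov D D' (ConformalEquiv.ofInjOn Φ D.isOpen hΦd hΦi hD'.symm) Φ ?_ ?_ heq
  · rw [h0]
    exact ConformalEquiv.hasBoundaryValue_of_eqOn _ heq _
  · rw [h1]
    exact ConformalEquiv.hasBoundaryValue_of_eqOn _ heq _

/-- **Conformal covariance implies Radó continuity** for a family of finite laws each carried by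
curves in the closed domain: `P D_n = (Φ_n)_* (P D)` and `P D' = Φ_* (P D)` by covariance
(`eq_map_of_image`), `∫ f d((Φ_n)_* P D) = ∫ f (Φ_n ∘ γ) dP D(γ)`, and for `P D`-a.e. `γ`
(trace in `closure D`) `Φ_n ∘ γ → Φ ∘ γ` in curve space
(`CurveClass.tendsto_map_of_tendstoUniformlyOn`), so `∫ f d(P D_n) → ∫ f d(P D')` by dominated
convergence (`|f| ≤ ‖f‖`). The mechanism of the remark "trivially implied by the conjunct" of
item `stmt-CriticalPhenomena-7305`. [folklore] -/
theorem IsConformallyCovariant.isRadoContinuous (hcov : P.IsConformallyCovariant)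
    (hfin : ∀ D : DobrushinDomain, IsFiniteMeasure (P D))
    (hcar : ∀ D : DobrushinDomain, ∀ᵐ γ ∂(P D), CurveClass.range γ ⊆ closure D.carrier) :
    P.IsRadoContinuous := by
  intro D D' Dn Φ Φn hunif hΦd hΦi hΦn hD' h0 h1 hDn f
  haveI := hfin D
  have hD'eq : P D' = (P D).map (CurveClass.map Φ) :=
    hcov.eq_map_of_image hΦd (hΦi.mono subset_closure) hD' h0 h1
  have hDneq : ∀ n, P (Dn n) = (P D).map (CurveClass.map (Φn n)) := fun n ↦
    hcov.eq_map_of_image (hΦn n).1 ((hΦn n).2.mono subset_closure) (hDn n).1 (hDn n).2.1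
      (hDn n).2.2
  have hint : ∀ Ψ : C(ℂ, ℂ),
      ∫ γ, f γ ∂((P D).map (CurveClass.map Ψ)) = ∫ γ, f (CurveClass.map Ψ γ) ∂(P D) := fun Ψ ↦
    integral_map (CurveClass.measurable_map Ψ).aemeasurable f.continuous.aestronglyMeasurable
  simp_rw [hDneq, hD'eq, hint]
  refine tendsto_integral_of_dominated_convergence (fun _ ↦ ‖f‖)
    (fun n ↦ (f.continuous.comp (CurveClass.continuous_map _)).aestronglyMeasurable)
    (integrable_const _) (fun n ↦ Eventually.of_forall fun γ ↦ f.norm_coe_le_norm _) ?_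
  filter_upwards [hcar D] with γ hγ
  exact (f.continuous.tendsto _).comp (CurveClass.tendsto_map_of_tendstoUniformlyOn hunif γ hγ)

/-- **A conformally covariant chordal family is Radó-continuous.** [folklore] -/
theorem IsConformallyCovariant.isRadoContinuous_of_isChordal (hcov : P.IsConformallyCovariant)
    (hP : P.IsChordal) : P.IsRadoContinuous :=
  hcov.isRadoContinuous (fun D ↦ by haveI := (hP D).1; infer_instance) fun D ↦
    ((hP D).2.mono fun _ h ↦ h.2.2)

/-- **A family of chordal SLE_κ laws is Radó-continuous** (every `κ`), from three named facts of
the tree taken as explicit hypotheses (each is DISCHARGED in a leaf file; they are hypotheses here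
only to keep those import cones out of this definition file): SLE_κ laws are probability measures
(`IsSLELaw.isProbabilityMeasure` under the Kolmogorov-extension fact
`Process.isProjectiveLimit_preWienerMeasure` = `hW`, discharged by
`isProjectiveLimit_preWienerMeasure_holds` in `LocalMartingaleProofs.lean`), carried by curves in
`closure D` (`IsSLELaw.ae_endpoints` under Carathéodory's `JordanDomain.mapsTo_boundaryExtension`
= `h₈`, discharged by `JordanDomain.mapsTo_boundaryExtension_holds` in
`CaratheodoryHalfPlaneProofs.lean`), and conformally covariant between Dobrushin domains
(`IsSLELaw.conformalCovariance` = `hcc`, discharged by `IsSLELaw.conformalCovariance_holds` in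
`ConformalRestrictionCovariance.lean`, Lawler 2005 §6.1/§6.3); then
`IsConformallyCovariant.isRadoContinuous` applies. This is the remark of item
`stmt-CriticalPhenomena-7305` that its conclusion is "trivially implied by the conjunct". Lawler,
*Conformally Invariant Processes in the Plane* (2005), §6.3. [cite: Lawler2005, §6.3] -/
theorem isRadoContinuous_of_isSLELaw (hW : Process.isProjectiveLimit_preWienerMeasure)
    (hcc : IsSLELaw.conformalCovariance) (h₈ : JordanDomain.mapsTo_boundaryExtension) {κ : ℝ≥0}
    {Q : ChordalFamily} (hQ : ∀ D : DobrushinDomain, IsSLELaw κ D (Q D)) : Q.IsRadoContinuous := by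
  haveI : Fact Process.isProjectiveLimit_preWienerMeasure := ⟨hW⟩
  have hcov : Q.IsConformallyCovariant := fun D D' g Φ h0 h1 hΦ ↦
    hcc D D' g Φ (hQ D) (hQ D') h0 h1 hΦ
  refine hcov.isRadoContinuous (fun D ↦ ?_) fun D ↦
    ((hQ D).ae_endpoints h₈).mono fun _ h ↦ h.2.2
  haveI := (hQ D).isProbabilityMeasure
  infer_instance

/-! #### An unconditional inhabitant -/

/-- **The degenerate family "stay at `a`" is Radó-continuous**: `tipFamily D_n` is the Dirac mass
at the constant curve at `Φ_n a`, and `Φ_n a → Φ a` (`a ∈ closure D`), so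
`∫ f d(tipFamily D_n) = f [const (Φ_n a)] → f [const (Φ a)] = ∫ f d(tipFamily D')`. [folklore] -/
theorem isRadoContinuous_tipFamily : tipFamily.IsRadoContinuous := by
  intro D D' Dn Φ Φn hunif _ _ _ _ h0 _ hDn f
  have hpt : Tendsto (fun n ↦ (Dn n).pt 0) atTop (𝓝 (D'.pt 0)) := by
    rw [h0, show (fun n ↦ (Dn n).pt 0) = fun n ↦ Φn n (D.pt 0) from funext fun n ↦ (hDn n).2.1]
    exact hunif.tendsto_at (frontier_subset_closure (D.pt_mem_frontier 0))
  simp only [tipFamily, integral_dirac]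
  exact ((f.continuous.comp CurveClass.continuous_mk_const).tendsto _).comp hpt

end ChordalFamily

end Literature.Probability.RandomPlanarGeometry

end
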